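import Mathlib
import HarnessLib

/-!
# The span lemma behind LEMMA Ξ and LEMMA I: pairs `(X v, Xᵀ u)` fill exactly the hyperplane
# `{(p, q) : u ⬝ p = v ⬝ q}` (WEIL-2 gen 24)

research route, not a corollary; conditional on HC_CM plus one named minimal statement.

Cell `pub-hodge-ring2-ab-*` (ALL ABELIAN VARIETIES), seat WEIL-2 gen 24, §2.2 (LEMMA Ξ) and §7 (LEMMA I) of
`run/shared/lean/pub/pub-hodge-ring2/pub-hodge-ring2-ab-weil-2/FLAT-G24.md`.

Informal setting (not formalised).  On `Y₀ = E_ω⁶` the tangent space of the Weil family is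
`T S = {k = [[0, X], [d₋⁻¹ Xᵀ d₊, 0]] : X ∈ M₃}`, so for a covector `r = (r₊, r₋)` the set
`S_r = {kᵀ r : k ∈ T S} = {(d₊ X d₋⁻¹ r₋, Xᵀ r₊) : X ∈ M₃}` is, up to the invertible diagonal factors, the
set of pairs `(X v, Xᵀ u)` with `u = r₊`, `v = d₋⁻¹ r₋`.  LEMMA Ξ (i) / LEMMA I need: for `u ≠ 0 ≠ v` this set
is EXACTLY the hyperplane `{(p, q) : u ⬝ p = v ⬝ q}` of dimension `2·3 − 1 = 5`.  Consequences in the account: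
the classification of the quotients `g : Y₀ → B` whose base-translation content `Ξ_g` is not all of `Lie B`
(exceptional kernels: block-interior of dimension ≤ 2, or an `H`-isotropic elliptic curve), and the dimension
count «an elliptic curve `E_n ⊂ Y₀` survives along 5 directions of `T S` iff `n` is `H`-isotropic
(`θ₊(n) = θ₋(n)`), along 4 otherwise».

This file proves the two inclusions over any field and any finite index type:
* `dotProduct_mulVec_eq_dotProduct_transpose_mulVec` — every pair `(X v, Xᵀ u)` lies on the hyperplane;
* `exists_mulVec_eq_and_transpose_mulVec_eq` — every point of the hyperplane is such a pair, provided `u` and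
  `v` each have a non-zero coordinate (explicit rank-≤ 3 matrix).

0 sorry, no `def`, no named fact; `HC_CM` does not occur.

## References

* [vanGeemen1994HodgeAV] B. van Geemen, An introduction to the Hodge conjecture for abelian varieties,
  LNM 1594, §5 — the tangent space of a Weil-type family as `Hom(V₊, V̄₋)` (context only).
-/

namespace Summit.HodgeConjecture.Ring2AbelianAll.NonsplitXiSpan

open Matrix

variable {K : Type*} [Field K] {n : Type*} [Fintype n] [DecidableEq n]

omit [DecidableEq n] in
/-- **The easy inclusion.** `u ⬝ (X v) = v ⬝ (Xᵀ u)` for every square matrix `X`: the pairs `(X v, Xᵀ u)` lie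
on the hyperplane `{(p,q) : u ⬝ p = v ⬝ q}`.
research route, not a corollary; conditional on HC_CM plus one named minimal statement.
[locator FLAT-G24 §2.2 LEMMA Ξ (i); linear algebra] -/
theorem dotProduct_mulVec_eq_dotProduct_transpose_mulVec (X : Matrix n n K) (u v : n → K) :
    u ⬝ᵥ (X *ᵥ v) = v ⬝ᵥ (Xᵀ *ᵥ u) := by
  rw [dotProduct_mulVec, mulVec_transpose, dotProduct_comm]

/-- **The hard inclusion (explicit witness).** If `u a ≠ 0`, `v b ≠ 0` and `u ⬝ p = v ⬝ q`, then
`X := p ⊗ e_b / v b + e_a ⊗ q / u a − c · e_a ⊗ e_b` with `c = (v ⬝ q)/(u a · v b)` satisfies `X v = p` and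
`Xᵀ u = q`.  Hence `{(X v, Xᵀ u)}` is the whole hyperplane, of codimension one.
research route, not a corollary; conditional on HC_CM plus one named minimal statement.
[locator FLAT-G24 §2.2 LEMMA Ξ (i), §7 LEMMA I] -/
theorem exists_mulVec_eq_and_transpose_mulVec_eq {u v p q : n → K} {a b : n}
    (ha : u a ≠ 0) (hb : v b ≠ 0) (h : u ⬝ᵥ p = v ⬝ᵥ q) :
    ∃ X : Matrix n n K, X *ᵥ v = p ∧ Xᵀ *ᵥ u = q := by
  set c : K := (v ⬝ᵥ q) * (u a)⁻¹ * (v b)⁻¹ with hc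
  refine ⟨vecMulVec p (Pi.single b (v b)⁻¹) + vecMulVec (Pi.single a (u a)⁻¹) q
      - vecMulVec (Pi.single a c) (Pi.single b 1), ?_, ?_⟩
  · -- X v = p
    rw [sub_mulVec, add_mulVec, vecMulVec_mulVec, vecMulVec_mulVec, vecMulVec_mulVec]
    simp only [single_dotProduct, op_smul_eq_smul, one_mul]
    ext i
    simp only [Pi.add_apply, Pi.sub_apply, Pi.smul_apply, smul_eq_mul, Pi.single_apply]
    by_cases hi : i = a
    · subst hi
      simp only [if_true]
      rw [hc, dotProduct_comm q v]
      field_simp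
      ring
    · simp only [hi, if_false, mul_zero, sub_zero, add_zero]
      field_simp
  · -- Xᵀ u = q
    rw [transpose_sub, transpose_add, transpose_vecMulVec, transpose_vecMulVec, transpose_vecMulVec,
      sub_mulVec, add_mulVec, vecMulVec_mulVec, vecMulVec_mulVec, vecMulVec_mulVec]
    simp only [single_dotProduct, op_smul_eq_smul]
    ext i
    simp only [Pi.add_apply, Pi.sub_apply, Pi.smul_apply, smul_eq_mul, Pi.single_apply]
    by_cases hi : i = b
    · subst hi
      simp only [if_true, mul_one]
      rw [dotProduct_comm p u, h, hc]
      field_simp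
      ring
    · simp only [hi, if_false, mul_zero, sub_zero, zero_add]
      field_simp

end Summit.HodgeConjecture.Ring2AbelianAll.NonsplitXiSpan
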